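import Summits.BirchSwinnertonDyer.BirchSwinnertonDyer.Theorems.ResidualThetaTransportAtTwoSignedMuVanishingAtTwoPlusCuspSpanGamma1
import Summits.BirchSwinnertonDyer.BirchSwinnertonDyer.Theorems.ResidualThetaTransportAtTwoCuspSpanDefs
import HarnessLib

/-!
# Route `ResidualThetaTransportAtTwo`, crux Kμ⁺ `SignedMuVanishingAtTwoPlus` (stmt-BirchSwinnertonDyer-20689): the
# analysis-free forms of this seat imply the lead's NAMED residue `SignedMuAtTwo.CuspSpanEvenAtTwo N` BY NAME

Cell `bsd-wall`, width seat `bsd-wall-rtt-p4-w3` (g3). THEOREMS ONLY; BSD is not proved by this. Lead g5 named the curve-free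
spanning hypothesis (G′)_N as the `@[conjecture]` predicate `SignedMuAtTwo.CuspSpanEvenAtTwo N` (`…CuspSpanDefs`, p595076; by-name
consumers `…CuspSpanNamed`, p596171). This seat's `…CuspSpanGroup` / `…CuspSpanGamma1` (p594698 / p595087) proved that the TRACE
form (G″)_N and the MEMBERSHIP form `Γ₁'(N) ≤ M_N` imply (G′)_N spelled inline; here the same two implications are stated
against the NAMED predicate (definitional unfolding, `cuspSpanEvenAtTwo_iff`), so that a planner's node «∀ odd N,
CuspSpanEvenAtTwo N» is implied BY NAME by «∀ odd N, Γ₁'(N) ≤ M_N» — one inclusion of subgroups of `SL(2, ℤ)` per level: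

* `cuspSpanEvenAtTwo_of_cuspSpanTrace` — (G″)_N ⟹ `CuspSpanEvenAtTwo N`;
* `cuspSpanEvenAtTwo_of_gamma1_le_closure` — `Gamma1' N ≤ closure({|tr γ| ≤ 2} ∪ {|d γ| = 4^k, k ≥ 1} ∪ {g²} ∪ commutatorSet)`
  ⟹ `CuspSpanEvenAtTwo N`;
* `forall_cuspSpanEvenAtTwo_of_forall_gamma1_le_closure` — the class-wide node from the class-wide inclusion.

References: [Knapp1993] Prop. 11.1, 11.22; [Pollack2003] Conj. 6.3; [Mazur1977] §II.11.
-/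

set_option autoImplicit false
set_option linter.dupNamespace false

noncomputable section

open scoped MatrixGroups

open CongruenceSubgroup

namespace Summit.BirchSwinnertonDyer.BirchSwinnertonDyer.Theorems.SignedMuAtTwo

variable {N : ℕ} [NeZero N]

/-- **(G″)_N ⟹ `CuspSpanEvenAtTwo N`** (the named (G′)_N): the trace form — every additive `χ : Γ₀(N) → ZMod 2` killing the
elements of trace `0, ±1, ±2` and the elements with `|d| = 4^k`, `k ≥ 1`, is `ψ ∘ d` — implies the lead's named predicate
(`cuspSpan_of_cuspSpanTrace`, definitional unfolding). [cite: Knapp1993, Prop. 11.1] [cite: Pollack2003, Conj. 6.3] -/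
theorem cuspSpanEvenAtTwo_of_cuspSpanTrace
    (hG : ∀ χ : Gamma0 N → ZMod 2,
      (∀ γ δ : Gamma0 N, χ (γ * δ) = χ γ + χ δ) →
      (∀ γ : Gamma0 N, ((γ : SL(2, ℤ)) 0 0 + (γ : SL(2, ℤ)) 1 1).natAbs ≤ 2 → χ γ = 0) →
      (∀ γ : Gamma0 N, (∃ k : ℕ, 1 ≤ k ∧ ((γ : SL(2, ℤ)) 1 1).natAbs = 4 ^ k) → χ γ = 0) →
      ∃ ψ : ZMod N → ZMod 2, (∀ x y : ZMod N, IsUnit x → IsUnit y → ψ (x * y) = ψ x + ψ y) ∧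
        ∀ γ : Gamma0 N, χ γ = ψ ((((γ : SL(2, ℤ)) 1 1 : ℤ) : ZMod N))) :
    CuspSpanEvenAtTwo N :=
  (cuspSpanEvenAtTwo_iff N).mpr (cuspSpan_of_cuspSpanTrace hG)

/-- **`Γ₁'(N) ≤ M_N` ⟹ `CuspSpanEvenAtTwo N`**: if every `γ ∈ Γ₀(N)` with `d(γ) ≡ 1 (mod N)` is a product of elements of trace
`0, ±1, ±2`, elements with lower-right entry `±4^k` (`k ≥ 1`), squares and commutators of `Γ₀(N)`, then the lead's named residue
(G′)_N holds at `N` (`cuspSpanTrace_of_gamma1_le_closure`, then the previous theorem). [cite: Knapp1993, Prop. 11.22]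
[cite: Pollack2003, Conj. 6.3] -/
theorem cuspSpanEvenAtTwo_of_gamma1_le_closure
    (hM : Gamma1' N ≤ Subgroup.closure
      ({γ : Gamma0 N | ((γ : SL(2, ℤ)) 0 0 + (γ : SL(2, ℤ)) 1 1).natAbs ≤ 2} ∪
        {γ : Gamma0 N | ∃ k : ℕ, 1 ≤ k ∧ ((γ : SL(2, ℤ)) 1 1).natAbs = 4 ^ k} ∪
        {γ : Gamma0 N | ∃ g : Gamma0 N, g * g = γ} ∪ commutatorSet (Gamma0 N))) :
    CuspSpanEvenAtTwo N :=
  cuspSpanEvenAtTwo_of_cuspSpanTrace (cuspSpanTrace_of_gamma1_le_closure hM)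

/-- **The class-wide node from the class-wide inclusion**: «for every odd `N`, `Γ₁'(N) ≤ M_N`» ⟹ «for every odd `N`,
`CuspSpanEvenAtTwo N`» — the hypothesis of the lead's `flatMuZeroAtTwo_of_forall_cuspSpanEvenAtTwo` /
`signedMuAnalyticAtTwoPlus_of_abbesUllmo_of_forall_cuspSpanEvenAtTwo` (p596171). [cite: Pollack2003, Conj. 6.3] -/
theorem forall_cuspSpanEvenAtTwo_of_forall_gamma1_le_closure
    (hM : ∀ (N : ℕ) [NeZero N], ¬ 2 ∣ N → Gamma1' N ≤ Subgroup.closure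
      ({γ : Gamma0 N | ((γ : SL(2, ℤ)) 0 0 + (γ : SL(2, ℤ)) 1 1).natAbs ≤ 2} ∪
        {γ : Gamma0 N | ∃ k : ℕ, 1 ≤ k ∧ ((γ : SL(2, ℤ)) 1 1).natAbs = 4 ^ k} ∪
        {γ : Gamma0 N | ∃ g : Gamma0 N, g * g = γ} ∪ commutatorSet (Gamma0 N))) :
    ∀ (N : ℕ) [NeZero N], ¬ 2 ∣ N → CuspSpanEvenAtTwo N :=
  fun N _ hN ↦ cuspSpanEvenAtTwo_of_gamma1_le_closure (hM N hN)

end Summit.BirchSwinnertonDyer.BirchSwinnertonDyer.Theorems.SignedMuAtTwo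

end
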